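import Summits.QuantumFields.QCD.Theorems.SpectralDefectExtinctionTipPricingBoxBlockIndex
import Summits.QuantumFields.QCD.Theorems.SpectralDefectExtinctionTipPricingTilingExists
import Summits.QuantumFields.QCD.Theorems.SpectralDefectExtinctionTipPricingTemplatePos
import Summits.QuantumFields.QCD.Theorems.SpectralDefectExtinctionTipPricingSpreadCapped
import Summits.QuantumFields.QCD.Theorems.SpectralDefectExtinctionWindowExtinctionStubSpreadFromPartsR3
import Summits.QuantumFields.QCD.Theorems.SpectralDefectExtinctionWindowExtinctionStubFluxTemplateHalf
import Summits.QuantumFields.QCD.Theorems.SpectralDefectExtinctionWindowExtinctionStubInertiaMonotone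
import Summits.QuantumFields.QCD.Theorems.SpectralDefectExtinctionWindowExtinctionStubNegCountMeasurable
import Summits.QuantumFields.QCD.Theorems.SpectralDefectExtinctionWindowExtinctionStubImplantCost
import Summits.QuantumFields.QCD.Theorems.SpectralDefectExtinctionWindowExtinctionStubDetQuasilocal
import Summits.QuantumFields.QCD.Theorems.SpectralDefectExtinctionWindowExtinctionStubAntichainWeight
import Summits.QuantumFields.QCD.Theorems.SpectralDefectExtinctionWindowExtinctionStubFiberAtomMonotone
import Summits.QuantumFields.QCD.Theorems.SpectralDefectExtinctionWindowExtinctionStubActiveCoresAbundant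
import Literature.MathematicalPhysics.QuantumFieldTheory.QCDPhaseQuenched

/-!
# Stub `stub_spreadOfCells` (A2, final assembly ASM3): the cell lemma implies the fixed-coupling index spread `C⁺`

Registered skeleton stub A2 of line `hermitian-flow-coarea` (reshape r3, lead c2) of crux
`Summit.QuantumFields.QCD.Theses.SpectralDefectExtinction.TipPricing` (item stmt-QuantumFields-8967): `CellLemma →
FixedCouplingSpread`, both inlined.  Everything analytic is landed; this file is the plumbing.

* **Monotone pair (`monotonePair_of_cells`).**  Fix a big box `{−R..R}⁴` tiled exactly by `N ≥ 96(2R+1)³ + 1`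
  cells-with-collars `z k + {−(ℓ+W)..ℓ+W}⁴` (`W ≥ 2`, centres in `3ℤ⁴`).  The tiled template class `Tp` (every cell content
  in the cell class `Tc`, every collar link entrywise `η`-close to the centre-flux pattern in cell-relative coordinates) and
  a class `Tm` whose box block of `H = Γ₅ D_W(·, −δ, 1)` is invertible with exactly `6(2R+1)⁴` negative eigenvalues form a
  `MonotonePair` at `δ`, provided every cell-with-collar with content in `Tc` and collar `τ`-close to the pattern (`η ≤ τ`)
  has the norm gap `g` and at least `6(2(ℓ+W)+1)⁴ + e` negative eigenvalues (`e ≥ 1`), `0 ≤ δ`, `0 < g₁ ≤ 3/8 − δ − 12η` and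
  the Schur-locality error at `(R, W, g₁)` is below `g`.  Indeed, for `U, U'` agreeing off the image of the box with
  `U|box ∈ Tm`, `U'|box ∈ Tp`, the box block of `H(U')` is invertible with at least `6(2R+1)⁴ + N·e ≥ 6(2R+1)⁴ + 96(2R+1)³ + 1`
  negative eigenvalues by the landed ASM1 `boxBlock_index_of_cells` — its cell hypothesis is the cell property read at the
  centres `c + z k` (content and collar clauses of `Tp`), its wall hypothesis is the collar clause of `Tp` with the covering
  and `3 ∣ z k i` (cell-relative and global centre-flux patterns agree, `cellPhase_shift`) — and 8964's landed S7
  `stub_inertiaMonotone` turns the inertia gap of the box blocks into `n₋(H(U')) ≥ n₋(H(U)) + 1`.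
* **Capped template pairs from cells.**  Fix an aspect ratio `Q`; the cell lemma gives a cap `h₀(Q)`; take
  `hT := min h₀ (1/4)`.  For a window `0 < lo ≤ hi ≤ Q·lo`, `hi ≤ hT` the cell lemma supplies `ℓ, W₀, e ≥ 1, g > 0, τ > 0` and
  the cell class `Tc`.  With the wall tolerance `η := min τ (1/200)` and the wall constant `g₁ := 1/8 − 12η > 0` (so that
  `g₁ ≤ 3/8 − δ − 12η` for every probe `δ ≤ 1/4`), the landed ASM2 `tiling_exists` gives the collar width `W ≥ max W₀ 2`, the
  big box `{−R..R}⁴`, and `N ≥ 96(2R+1)³ + 1` cells-with-collars with centres in `3ℤ⁴` tiling it, with Schur-locality error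
  below `g`.  `Tp` is the tiled template class of the landed TP `tiledTemplate_measurable_pos` (measurable, Haar-positive),
  `Tm` the centre-flux class of 8964's landed `stub_fluxTemplateHalf` (measurable, Haar-positive, box block invertible with
  inertia exactly half at `|δ| ≤ 1/4`); they form a monotone pair at every probe of the window by the first bullet.
* **`C⁺_sub` for every `N_f`.**  Feed the capped template pairs and 8964's landed S1–S5a (`stub_negCountMeasurable`,
  `stub_implantCost`, `stub_detQuasilocal`, `stub_antichainWeight`, `stub_fiberAtomMonotone`, `stub_activeCoresAbundant`)
  into the landed capped S6′ `fixedCouplingIndexSpreadSub_of_cappedTemplatePair`.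
* **Cast bridge.**  `FixedCouplingIndexSpreadSub N_f` is the conclusion with the deep index written over `ℤ`; unfold
  `absIndexMean`/`deepIndex`/`negCount` and `push_cast` (adapted from the lead's skeleton `fixedCouplingSpread_of_sub`).

Supports stmt-QuantumFields-8967 (stub `stub_spreadOfCells`, A2, of line `hermitian-flow-coarea`).  No named facts.
-/

noncomputable section

namespace Summit.QuantumFields.QCD.Cruxes.TipPricing.HermitianFlowCoarea

open MeasureTheory Matrix
open Literature.MathematicalPhysics.QuantumLattice Literature.MathematicalPhysics.QuantumFieldTheory
  Literature.Probability.LatticeModels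
open Summit.QuantumFields.QCD.Theorems.ExtinctionBuildsQCD.Negative
open Summit.QuantumFields.QCD.Cruxes.TipPricing.ModularTemplate
open Summit.QuantumFields.QCD.Cruxes.WindowExtinction.FreeVolumeHeavyWitness
open scoped BigOperators

/-! ### The monotone pair of the tiled class and the flux class -/

/-- The centre-flux phase is `3`-periodic in the coordinate: shifting by a multiple of `3` does not change `e^{2πi m/3}`. -/
theorem cellPhase_shift {m : ℤ} (hm : (3 : ℤ) ∣ m) (a : ℤ) :
    Complex.exp (2 * Real.pi * Complex.I * ((m + a : ℤ) : ℂ) / 3) =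
      Complex.exp (2 * Real.pi * Complex.I * ((a : ℤ) : ℂ) / 3) := by
  obtain ⟨q, rfl⟩ := hm
  have h : (2 * Real.pi * Complex.I * ((3 * q + a : ℤ) : ℂ) / 3 : ℂ) =
      2 * Real.pi * Complex.I * ((a : ℤ) : ℂ) / 3 + q * (2 * Real.pi * Complex.I) := by
    push_cast
    ring
  rw [h, Complex.exp_add, Complex.exp_int_mul_two_pi_mul_I, mul_one]

/-- **The tiled class and the flux class form a monotone pair** (see the module docstring, first bullet). -/
theorem monotonePair_of_cells (ℓ W R N e : ℕ) (z : Fin N → (Fin 4 → ℤ)) (hW : 2 ≤ W)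
    (hin : ∀ k, ∀ (y : Fin 4 → ℤ), y ∈ box 4 (ℓ + W) → z k + y ∈ box 4 R)
    (hdisj : ∀ k k', k ≠ k' → ∀ (y y' : Fin 4 → ℤ), y ∈ box 4 (ℓ + W) → y' ∈ box 4 (ℓ + W) →
      z k + y ≠ z k' + y')
    (hcover : ∀ (x : Fin 4 → ℤ), x ∈ box 4 R → ∃ (k : Fin N) (y : Fin 4 → ℤ), y ∈ box 4 (ℓ + W) ∧ x = z k + y)
    (h3 : ∀ (k : Fin N) (i : Fin 4), (3 : ℤ) ∣ z k i)
    (hN : 96 * (2 * R + 1) ^ 3 + 1 ≤ N) (he : 1 ≤ e)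
    (Tc : Set ((↥(box 4 ℓ) × Fin 4) → SU3)) (Tm : Set (Tmpl R))
    (δ η τ g g₁ : ℝ) (hδ : 0 ≤ δ) (hη : 0 ≤ η) (hητ : η ≤ τ) (hg : 0 < g) (hg₁ : 0 < g₁)
    (hg₁le : g₁ ≤ 3 / 8 - δ - 12 * η)
    (hε : 12 * (2 * (R : ℝ) + 1) ^ 4 * (96 * (2 / g₁) * (12 * (2 * (R : ℝ) + 1) ^ 4 * 96) *
          (2 / g₁ * Real.exp (-(g₁ / 400 * ((W : ℝ) - 1)))) * 96) < g)
    (hTm : ∀ (n : ℕ) [NeZero n], 2 * R + 1 < n → ∀ (c : Fin 4 → ℤ) (U : GaugeConfig 4 n SU3),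
          (fun yi : ↥(box 4 R) × Fin 4 => U (Torus.proj n (c + (yi.1 : Fin 4 → ℤ)), yi.2)) ∈ Tm →
          ((spinorLift gammaFive * wilsonDirac (fundamentalRep (Fin 3)) U (-δ) 1).submatrix
              (Subtype.val : {p : TorusSite 4 n × Fin 3 × Fin 4 //
                ∃ y : ↥(box 4 R), Torus.proj n (c + (y : Fin 4 → ℤ)) = p.1} → _) Subtype.val).det ≠ 0 ∧
          negRootCount ((spinorLift gammaFive * wilsonDirac (fundamentalRep (Fin 3)) U (-δ) 1).submatrix
              (Subtype.val : {p : TorusSite 4 n × Fin 3 × Fin 4 //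
                ∃ y : ↥(box 4 R), Torus.proj n (c + (y : Fin 4 → ℤ)) = p.1} → _) Subtype.val) =
            6 * (2 * R + 1) ^ 4)
    (hcellW : ∀ (n : ℕ) [NeZero n], 2 * (ℓ + W) + 1 < n →
          ∀ (c : Fin 4 → ℤ) (U : GaugeConfig 4 n SU3),
            (fun yi : ↥(box 4 ℓ) × Fin 4 => U (Torus.proj n (c + (yi.1 : Fin 4 → ℤ)), yi.2)) ∈ Tc →
            (∀ y : Fin 4 → ℤ, y ∈ box 4 (ℓ + W) → y ∉ box 4 ℓ → ∀ (μ : Fin 4) (i j : Fin 3),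
              ‖(↑(U (Torus.proj n (c + y), μ)) : Matrix (Fin 3) (Fin 3) ℂ) i j -
                (if i = j then (if μ = 1 then Complex.exp (2 * Real.pi * Complex.I * ((y 0 : ℤ) : ℂ) / 3)
                  else if μ = 3 then Complex.exp (2 * Real.pi * Complex.I * ((y 2 : ℤ) : ℂ) / 3) else 1)
                 else 0)‖ ≤ τ) →
            (∀ v : {p : TorusSite 4 n × Fin 3 × Fin 4 //
                ∃ y : ↥(box 4 (ℓ + W)), Torus.proj n (c + (y : Fin 4 → ℤ)) = p.1} → ℂ,
              g ^ 2 * ∑ i, ‖v i‖ ^ 2 ≤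
                ∑ i, ‖(((spinorLift gammaFive * wilsonDirac (fundamentalRep (Fin 3)) U (-δ) 1).submatrix
                  (Subtype.val : {p : TorusSite 4 n × Fin 3 × Fin 4 //
                    ∃ y : ↥(box 4 (ℓ + W)), Torus.proj n (c + (y : Fin 4 → ℤ)) = p.1} → _) Subtype.val) *ᵥ v)
                    i‖ ^ 2) ∧
            6 * (2 * (ℓ + W) + 1) ^ 4 + e ≤
              negRootCount ((spinorLift gammaFive * wilsonDirac (fundamentalRep (Fin 3)) U (-δ) 1).submatrix
                (Subtype.val : {p : TorusSite 4 n × Fin 3 × Fin 4 //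
                  ∃ y : ↥(box 4 (ℓ + W)), Torus.proj n (c + (y : Fin 4 → ℤ)) = p.1} → _) Subtype.val)) :
    MonotonePair R {t : Tmpl R |
      (∀ k : Fin N, ∃ s ∈ Tc, ∀ (yi : ↥(box 4 ℓ) × Fin 4) (x : ↥(box 4 R)),
          (x : Fin 4 → ℤ) = z k + (yi.1 : Fin 4 → ℤ) → t (x, yi.2) = s yi) ∧
      (∀ (k : Fin N) (x : ↥(box 4 R)) (y : Fin 4 → ℤ), y ∈ box 4 (ℓ + W) → y ∉ box 4 ℓ →
          (x : Fin 4 → ℤ) = z k + y → ∀ (μ : Fin 4) (i j : Fin 3),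
            ‖(↑(t (x, μ)) : Matrix (Fin 3) (Fin 3) ℂ) i j -
                (if i = j then
                  (if μ = 1 then Complex.exp (2 * Real.pi * Complex.I * ((y 0 : ℤ) : ℂ) / 3)
                   else if μ = 3 then Complex.exp (2 * Real.pi * Complex.I * ((y 2 : ℤ) : ℂ) / 3) else 1)
                 else 0)‖ < η)} Tm δ := by
  intro n _ hn c U U' hagree hUm hU'p
  rw [Set.mem_setOf_eq] at hU'p
  obtain ⟨hP1, hP2⟩ := hU'p
  have hsub : ∀ (y : Fin 4 → ℤ), y ∈ box 4 ℓ → y ∈ box 4 (ℓ + W) := fun y hy =>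
    box_mono 4 (Nat.le_add_right ℓ W) hy
  -- the `Tm` side: invertible box block with inertia exactly half
  obtain ⟨hdet, hcnt⟩ := hTm n hn c U hUm
  -- the wall hypothesis of ASM1: the collar clause of `Tp`, read in global coordinates
  have hflux : ∀ (x : Fin 4 → ℤ), x ∈ box 4 R → (¬ ∃ (k : Fin N) (y : Fin 4 → ℤ), y ∈ box 4 ℓ ∧ x = z k + y) →
      ∀ (μ : Fin 4) (i j : Fin 3),
        ‖(↑(U' (Torus.proj n (c + x), μ)) : Matrix (Fin 3) (Fin 3) ℂ) i j -
            (if i = j then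
              (if μ = 1 then Complex.exp (2 * Real.pi * Complex.I * ((x 0 : ℤ) : ℂ) / 3)
               else if μ = 3 then Complex.exp (2 * Real.pi * Complex.I * ((x 2 : ℤ) : ℂ) / 3) else 1)
             else 0)‖ ≤ η := by
    intro x hx hnot μ i j
    obtain ⟨k, y, hy, rfl⟩ := hcover x hx
    have hyℓ : y ∉ box 4 ℓ := fun h => hnot ⟨k, y, h, rfl⟩
    have h := hP2 k ⟨z k + y, hx⟩ y hy hyℓ rfl μ i j
    rw [Pi.add_apply, Pi.add_apply, cellPhase_shift (h3 k 0), cellPhase_shift (h3 k 2)]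
    exact h.le
  -- the cell hypothesis of ASM1: the cell lemma at the centres `c + z k`
  have hcell : ∀ k : Fin N,
      (∀ v : {p : TorusSite 4 n × Fin 3 × Fin 4 //
          ∃ (y : ↥(box 4 (ℓ + W))), Torus.proj n (c + z k + (y : Fin 4 → ℤ)) = p.1} → ℂ,
        g ^ 2 * ∑ i, ‖v i‖ ^ 2 ≤
          ∑ i, ‖(((spinorLift gammaFive * wilsonDirac (fundamentalRep (Fin 3)) U' (-δ) 1).submatrix
            (Subtype.val : {p : TorusSite 4 n × Fin 3 × Fin 4 //
              ∃ (y : ↥(box 4 (ℓ + W))), Torus.proj n (c + z k + (y : Fin 4 → ℤ)) = p.1} → _) Subtype.val) *ᵥ v)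
              i‖ ^ 2) ∧
      6 * (2 * (ℓ + W) + 1) ^ 4 + e ≤
        negRootCount ((spinorLift gammaFive * wilsonDirac (fundamentalRep (Fin 3)) U' (-δ) 1).submatrix
          (Subtype.val : {p : TorusSite 4 n × Fin 3 × Fin 4 //
            ∃ (y : ↥(box 4 (ℓ + W))), Torus.proj n (c + z k + (y : Fin 4 → ℤ)) = p.1} → _) Subtype.val) := by
    intro k
    have hcontent : (fun yi : ↥(box 4 ℓ) × Fin 4 =>
        U' (Torus.proj n (c + z k + (yi.1 : Fin 4 → ℤ)), yi.2)) ∈ Tc := by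
      obtain ⟨s, hs, hsk⟩ := hP1 k
      convert hs using 1
      funext yi
      rw [add_assoc c (z k) _]
      exact hsk yi ⟨z k + _, hin k _ (hsub _ yi.1.2)⟩ rfl
    have hcollar : ∀ y : Fin 4 → ℤ, y ∈ box 4 (ℓ + W) → y ∉ box 4 ℓ → ∀ (μ : Fin 4) (i j : Fin 3),
        ‖(↑(U' (Torus.proj n (c + z k + y), μ)) : Matrix (Fin 3) (Fin 3) ℂ) i j -
          (if i = j then (if μ = 1 then Complex.exp (2 * Real.pi * Complex.I * ((y 0 : ℤ) : ℂ) / 3)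
            else if μ = 3 then Complex.exp (2 * Real.pi * Complex.I * ((y 2 : ℤ) : ℂ) / 3) else 1)
           else 0)‖ ≤ τ := by
      intro y hy hyℓ μ i j
      rw [add_assoc c (z k) y]
      exact (hP2 k ⟨z k + y, hin k y hy⟩ y hy hyℓ rfl μ i j).le.trans hητ
    exact hcellW n (cwc_side_lt ℓ W R N hn z hin k) (c + z k) U' hcontent hcollar
  -- ASM1: the box block of `H(U')` is invertible with inertia at least half plus `N e`
  obtain ⟨hdet', hcnt'⟩ := boxBlock_index_of_cells U' c ℓ W R N e hW hn z hin hdisj hcover h3 δ η g g₁ hδ hη hg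
    hg₁ hg₁le hflux hcell hε
  -- S7: the inertia gap of the box blocks gives the strict monotonicity of the index
  unfold negCount
  refine stub_inertiaMonotone n R hn c δ U U' hagree hdet hdet' ?_
  rw [hcnt]
  have h1 : N ≤ N * e := Nat.le_mul_of_pos_right N he
  have h2 : 96 * (2 * R + 1) ^ 3 + 1 ≤ N * e := hN.trans h1
  omega

/-! ### The stub -/

/-- **STUB A2 `stub_spreadOfCells`** (registered signature, inlined): the cell lemma implies the fixed-coupling index spread `C⁺`. -/
theorem stub_spreadOfCells :
    (∀ Q : ℕ, ∃ h₀ : ℝ, 0 < h₀ ∧ ∀ lo hi : ℝ, 0 < lo → lo ≤ hi → hi ≤ Q * lo → hi ≤ h₀ →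
      ∃ (ℓ W₀ e : ℕ) (g τ : ℝ) (Tc : Set ((↥(box 4 ℓ) × Fin 4) → SU3)), 1 ≤ e ∧ 0 < g ∧ 0 < τ ∧
        MeasurableSet Tc ∧ (Measure.pi fun _ : ↥(box 4 ℓ) × Fin 4 => haarProbability SU3) Tc ≠ 0 ∧
        ∀ W : ℕ, W₀ ≤ W → ∀ δ : ℝ, lo ≤ δ → δ ≤ hi → ∀ (n : ℕ) [NeZero n], 2 * (ℓ + W) + 1 < n →
          ∀ (c : Fin 4 → ℤ) (U : GaugeConfig 4 n SU3),
            (fun yi : ↥(box 4 ℓ) × Fin 4 => U (Torus.proj n (c + (yi.1 : Fin 4 → ℤ)), yi.2)) ∈ Tc →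
            (∀ y : Fin 4 → ℤ, y ∈ box 4 (ℓ + W) → y ∉ box 4 ℓ → ∀ (μ : Fin 4) (i j : Fin 3),
              ‖(↑(U (Torus.proj n (c + y), μ)) : Matrix (Fin 3) (Fin 3) ℂ) i j -
                (if i = j then (if μ = 1 then Complex.exp (2 * Real.pi * Complex.I * ((y 0 : ℤ) : ℂ) / 3)
                  else if μ = 3 then Complex.exp (2 * Real.pi * Complex.I * ((y 2 : ℤ) : ℂ) / 3) else 1)
                 else 0)‖ ≤ τ) →
            (∀ v : {p : TorusSite 4 n × Fin 3 × Fin 4 //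
                ∃ y : ↥(box 4 (ℓ + W)), Torus.proj n (c + (y : Fin 4 → ℤ)) = p.1} → ℂ,
              g ^ 2 * ∑ i, ‖v i‖ ^ 2 ≤
                ∑ i, ‖(((spinorLift gammaFive * wilsonDirac (fundamentalRep (Fin 3)) U (-δ) 1).submatrix
                  (Subtype.val : {p : TorusSite 4 n × Fin 3 × Fin 4 //
                    ∃ y : ↥(box 4 (ℓ + W)), Torus.proj n (c + (y : Fin 4 → ℤ)) = p.1} → _) Subtype.val) *ᵥ v) i‖ ^ 2) ∧
            6 * (2 * (ℓ + W) + 1) ^ 4 + e ≤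
              negRootCount ((spinorLift gammaFive * wilsonDirac (fundamentalRep (Fin 3)) U (-δ) 1).submatrix
                (Subtype.val : {p : TorusSite 4 n × Fin 3 × Fin 4 //
                  ∃ y : ↥(box 4 (ℓ + W)), Torus.proj n (c + (y : Fin 4 → ℤ)) = p.1} → _) Subtype.val)) →
    ∀ Nf : ℕ, (Nf = 2 ∨ Nf = 3) → ∀ Q : ℕ, ∃ h₀ : ℝ, 0 < h₀ ∧ ∀ β lo hi : ℝ, 0 ≤ β → 0 < lo → lo ≤ hi →
      hi ≤ Q * lo → hi * max β 1 ≤ h₀ → ∀ L₀ : ℕ, ∃ L' : ℕ, L₀ ≤ L' ∧ ∀ δ : ℝ, lo ≤ δ → δ ≤ hi →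
      ∀ μ : Fin Nf → ℝ, (∀ f, lo ≤ μ f ∧ μ f ≤ hi) → 1 ≤ qcdPhaseQuenchedExpect β (2 * L' + 1) μ
      (fun U : GaugeConfig 4 (2 * L' + 1) SU3 => |(Multiset.countP (fun z : ℂ => z.re < 0) (spinorLift
      gammaFive * wilsonDirac (fundamentalRep (Fin 3)) U (-δ) 1).charpoly.roots : ℝ) - 6 * (2 * (L' : ℝ) +
      1) ^ 4|) := by
  intro hCell
  ---- capped template pairs from the cell lemma
  have hTPc : ∀ Q : ℕ, ∃ hT : ℝ, 0 < hT ∧ ∀ lo hi : ℝ, 0 < lo → lo ≤ hi → hi ≤ Q * lo → hi ≤ hT →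
      ∃ (R : ℕ) (Tp Tm : Set (Tmpl R)), MeasurableSet Tp ∧ MeasurableSet Tm ∧
        tmplHaar R Tp ≠ 0 ∧ tmplHaar R Tm ≠ 0 ∧ ∀ δ : ℝ, lo ≤ δ → δ ≤ hi → MonotonePair R Tp Tm δ := by
    intro Q
    obtain ⟨h₀, hh₀, hQ⟩ := hCell Q
    refine ⟨min h₀ (1 / 4), lt_min hh₀ (by norm_num), fun lo hi hlo hlohi hQlo hhi => ?_⟩
    have hhi₀ : hi ≤ h₀ := hhi.trans (min_le_left _ _)
    have hhi4 : hi ≤ 1 / 4 := hhi.trans (min_le_right _ _)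
    obtain ⟨ℓ, W₀, e, g, τ, Tc, he, hg, hτ, hTc, hTc0, hcellQ⟩ := hQ lo hi hlo hlohi hQlo hhi₀
    -- the wall tolerance `η` and the wall constant `g₁`
    obtain ⟨η, hη_def⟩ : ∃ η : ℝ, η = min τ (1 / 200) := ⟨_, rfl⟩
    have hη : 0 < η := by rw [hη_def]; exact lt_min hτ (by norm_num)
    have hητ : η ≤ τ := by rw [hη_def]; exact min_le_left _ _
    have hη200 : η ≤ 1 / 200 := by rw [hη_def]; exact min_le_right _ _
    obtain ⟨g₁, hg₁_def⟩ : ∃ g₁ : ℝ, g₁ = 1 / 8 - 12 * η := ⟨_, rfl⟩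
    have hg₁ : 0 < g₁ := by rw [hg₁_def]; linarith
    -- the tiling (ASM2), the tiled class `Tp` (TP) and the centre-flux class `Tm` (S5b-m)
    obtain ⟨W, R, N, z, hW₀W, hW2, hin, hdisj, hcover, h3, hN, hε⟩ := tiling_exists ℓ W₀ g g₁ hg hg₁
    obtain ⟨hTpm, hTp0⟩ := tiledTemplate_measurable_pos ℓ W R N z hin hdisj Tc hTc hTc0 η hη
    obtain ⟨Tm, hTmm, hTm0, hflux⟩ := stub_fluxTemplateHalf R
    refine ⟨R, _, Tm, hTpm, hTmm, hTp0, hTm0, fun δ hδ1 hδ2 => ?_⟩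
    have hδ : 0 ≤ δ := hlo.le.trans hδ1
    have hδ4 : |δ| ≤ 1 / 4 := abs_le.2 ⟨by linarith, hδ2.trans hhi4⟩
    have hg₁le : g₁ ≤ 3 / 8 - δ - 12 * η := by rw [hg₁_def]; linarith [hδ2.trans hhi4]
    exact monotonePair_of_cells ℓ W R N e z hW2 hin hdisj hcover h3 hN he Tc Tm δ η τ g g₁ hδ hη.le hητ hg hg₁
      hg₁le hε (fun n _ hn c U hU => hflux δ hδ4 n hn c U hU)
      (fun n _ hn c U hc hcol => hcellQ W hW₀W δ hδ1 hδ2 n hn c U hc hcol)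
  ---- `C⁺_sub` for every `N_f` (capped S6′ over 8964's landed S1–S5a)
  have hsub : ∀ Nf : ℕ, FixedCouplingIndexSpreadSub Nf :=
    fixedCouplingIndexSpreadSub_of_cappedTemplatePair @stub_negCountMeasurable @stub_implantCost
      @stub_detQuasilocal @stub_antichainWeight @stub_fiberAtomMonotone @stub_activeCoresAbundant hTPc
  ---- the cast bridge
  -- adapted from the lead's skeleton `fixedCouplingSpread_of_sub` (Cruxes/TipPricing/Lines, lead c2)
  intro Nf _hNf Q
  obtain ⟨h₀, hh₀, hall⟩ := hsub Nf Q
  refine ⟨h₀, hh₀, fun β lo hi hβ hlo hlohi hQ hcap L₀ => ?_⟩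
  obtain ⟨L', hL₀, hwin⟩ := hall β lo hi hβ hlo hlohi hQ hcap L₀
  refine ⟨L', hL₀, fun δ hδ1 hδ2 μ hμ => ?_⟩
  have h1 := hwin δ hδ1 hδ2 μ hμ
  unfold absIndexMean deepIndex negCount at h1
  convert h1 using 4 with U
  push_cast
  ring

end Summit.QuantumFields.QCD.Cruxes.TipPricing.HermitianFlowCoarea

end
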